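import Summits.CriticalPhenomena.CardyFormulaZ2.Theorems.CardyAnchoredRigiditySubseqCardySelfDual
import Summits.CriticalPhenomena.CardyFormulaZ2.Theorems.CardyAnchoredRigiditySubseqCardyReduction

/-!
# The structure theorem of joint sequential limits (crux `SubseqCardy`, stmt-CriticalPhenomena-5768,
# line `registered`: structure of joint limits, summary of parts 1–8)

Route `CardyAnchoredRigidity` (decl shared with `CardyLocalRigidity`), sub-problem `CardyFormulaZ2`, lead c4.
One importable statement collecting what the lattice is known to impose UNCONDITIONALLY on every joint
sequential limit (`u → 0⁺`, `g`) of the bond-`ℤ²` crossing probabilities `bondDomainCrossingProb`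
(G02 discretisation) — i.e. on every element of the cluster set of the crossing-function path
(`clusterPt_iff_jointLimit`), the objects the open stubs S2 (⟺ item 8266, conformal invariance) and
S3 (⟺ item 8271, identification with Cardy) quantify over:

* `jointLimit_structure` (registered sub-goal): (1) invariance under all translations, (2) under the
  quarter turn and (3) complex conjugation (hence under the lattice symmetry group `D₄ ⋉ ℂ`),
  (4) SELF-DUALITY `g R + g R⁺ = 1` for the cyclic re-marking `R⁺` of every conformal rectangle,
  (5) non-degeneracy `0 < g R < 1` (RSW), (6) continuity in the Schramm–Smirnov topology, and
  (7) dilation INTERTWINING: `R ↦ g (c·R)` is again a joint sequential limit (along `u n / c`).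

Sources: parts 2 (`…JointLimitSymmetry`), 8 (`…SelfDual`), the Reduction file (`jointLimit_mem_Ioo`).
Rotation invariance by arbitrary angles is part 3, conditional on `dkkmo_crossing_rotation_invariance`,
and is deliberately not bundled here (this file is unconditional). What S2 asks beyond (1)–(7) is
dilation covariance of ONE limit and the Möbius/inversion step (barrier `ScaleCovarianceNotMoebius`).

References: O. Schramm, S. Smirnov, Ann. Probab. 39 (2011) §1.3, §5; G. Grimmett, *Percolation*
(1999) §11.2, §11.7.
-/

noncomputable section

namespace Summit.CriticalPhenomena.CardyFormulaZ2.Cruxes.SubseqCardy.Birth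

open Set Filter Topology Metric
open Literature.Probability.RandomPlanarGeometry (ConformalRectangle)
open Literature.Probability.Percolation (bondDomainCrossingProb)

/-- **Registered sub-goal `jointLimit_structure` (line `registered`, lead c4) — the structure theorem of
joint sequential limits.** If `u n → 0⁺` and `bondDomainCrossingProb R (u n) → g R` for every conformal
rectangle `R`, then: (1) `g (e + R) = g R` for every `e : ℂ`; (2) `g (i·R) = g R`; (3) `g (R̄) = g R`;
(4) `g R + g R⁺ = 1` whenever `R⁺` has the carrier of `R` and `R⁺.arc 0 = R.arc 1`, `R⁺.arc 2 = R.arc 3`;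
(5) `g R ∈ (0, 1)`; (6) for every `R` and `ε > 0` there is `η > 0` with `|g (T R) - g R| ≤ ε` for every
plane homeomorphism `T` moving `cthickening 1 (closure R)` by at most `η`; (7) for every `c > 0` the
function `R ↦ g (c·R)` is the joint limit along the mesh sequence `u n / c → 0⁺`.
[cite: SchrammSmirnov2011, §1.3 and §5] -/
theorem jointLimit_structure : ∀ u : ℕ → ℝ, Filter.Tendsto u Filter.atTop (nhdsWithin (0 : ℝ) (Set.Ioi 0)) → ∀ g : Literature.Probability.RandomPlanarGeometry.ConformalRectangle → ℝ, (∀ R : Literature.Probability.RandomPlanarGeometry.ConformalRectangle, Filter.Tendsto (fun n => Literature.Probability.Percolation.bondDomainCrossingProb R (u n)) Filter.atTop (nhds (g R))) → (∀ (R : Literature.Probability.RandomPlanarGeometry.ConformalRectangle) (e : ℂ), g (R.map (Homeomorph.addLeft e)) = g R) ∧ (∀ (R : Literature.Probability.RandomPlanarGeometry.ConformalRectangle) (T : ℂ ≃ₜ ℂ), (∀ z : ℂ, T z = Complex.I * z) → g (R.map T) = g R) ∧ (∀ (R : Literature.Probability.RandomPlanarGeometry.ConformalRectangle) (T : ℂ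 ≃ₜ ℂ), (∀ z : ℂ, T z = (starRingEnd ℂ) z) → g (R.map T) = g R) ∧ (∀ R R' : Literature.Probability.RandomPlanarGeometry.ConformalRectangle, R'.carrier = R.carrier → R'.arc 0 = R.arc 1 → R'.arc 2 = R.arc 3 → g R + g R' = 1) ∧ (∀ R : Literature.Probability.RandomPlanarGeometry.ConformalRectangle, g R ∈ Set.Ioo (0 : ℝ) 1) ∧ (∀ (R : Literature.Probability.RandomPlanarGeometry.ConformalRectangle) (ε : ℝ), 0 < ε → ∃ η : ℝ, 0 < η ∧ ∀ T : ℂ ≃ₜ ℂ, (∀ z ∈ Metric.cthickening 1 (closure R.carrier), dist (T z) z ≤ η) → |g (R.map T) - g R| ≤ ε) ∧ (∀ c : ℝ, 0 < c → ∀ T : ℂ ≃ₜ ℂ, (∀ z : ℂ, T z = (c : ℂ) * z) → Filter.Tendsto (fun n => u n / c) Filter.atTop (nhdsWithin (0 : ℝ) (Set.Ioi 0)) ∧ ∀ R : Literature.Probability.RandomPlanarGeometry.ConformalRectangle, Filter.Tendsto (fun n => Literature.Probability.Percolation.bondDomainCrossingProb R (u n / c)) Filter.atTop (nhds (g (R.map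 T)))) := by
  intro u hu g hg
  refine ⟨fun R e => JointLimit.map_addLeft hu hg R e, fun R T hT => JointLimit.map_mul_I hg T hT R,
    fun R T hT => JointLimit.map_conj hg T hT R,
    fun R R' hc h0 h2 => JointLimit.add_shift_eq_one hu hg R R' hc h0 h2,
    fun R => jointLimit_mem_Ioo hu hg R, fun R ε hε => JointLimit.abs_sub_map_le hu hg R hε,
    fun c hc T hT => ⟨JointLimit.tendsto_div_const hu hc, fun R => JointLimit.tendsto_dilate hg hc T hT R⟩⟩

end Summit.CriticalPhenomena.CardyFormulaZ2.Cruxes.SubseqCardy.Birth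

end
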